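import Literature.NumberTheory.GaloisRepresentations.LubinTateColemanTraceZero
import Literature.NumberTheory.GaloisRepresentations.LubinTateColemanLogDerivSurjTwo
import HarnessLib

/-!
# The image and kernel of `h ↦ h̃` on `𝓔_π`, and its `𝒪[F]ˣ`-equivariance

De Shalit, *Iwasawa theory of elliptic curves with complex multiplication* (1987), Ch. I §3.13 Lemma and §3.14
(exactness of (20): `0 → 𝒰 → 𝒪'⟦𝒢⟧ → 𝒪'(1) → 0`, through `δ` and `h ↦ h̃`).  Continuing
`LubinTateColemanTraceZero` (`tildeSer π u h = h − u·(h ∘ f)`, `f = πX + X^q`), for **`π = q·u`** we prove: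

* `colemanTrace_one`, `colemanTrace_C` — `𝒮1 = q`, `𝒮(a) = q a`; `tildeSer_C` — `ã = (1 − u) a`.
* ★★★ `exists_tildeSer_eq` — **the image of `𝓔_π` under `h ↦ h̃` is `{g : 𝒮g = 0, g(0) ∈ (1 − u)}`**: every `g` with
  `𝒮g = 0` and `g(0) = (1 − u) c` is `h̃` for some `h ∈ 𝓔_π` with `h(0) = c` (and `h̃(0) = (1−u)h(0)` always,
  `constantCoeff_tildeSer`); with `existsUnique_tildeSer_eq` (`c = 0`) and
* ★★ `tildeSer_eq_zero_iff` — **the kernel**: `h̃ = 0 ⟺ h = h(0)` is a constant with `(1 − u) h(0) = 0`; so for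
  `u ≠ 1` (`π ≠ q`) `h ↦ h̃` is injective (`tildeSer_injective`), and for `u = 1` (`π = q`, e.g. `𝔾̂_m` over `ℤ_p`)
  its kernel is exactly the constants `𝒪[F]` — de Shalit's exact sequence
  `0 → 𝒪' → 𝓔 → {g : 𝒮g = 0, g(0) = 0} → 0` on the power-series side.
* ★★ `tildeSer_subst_hom`, `colemanTrace_subst_hom_eq_zero` — `h ↦ h̃` commutes with `h ↦ h ∘ [v]_f` (`v ∈ 𝒪[F]`),
  and `{𝒮g = 0}` is stable under `∘ [v]_f` (`v ∈ 𝒪[F]ˣ`): the maps `𝒰 →δ 𝓔_π → {𝒮 = 0}` are compatible with the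
  `𝒪[F]ˣ`-actions (cf. `NormCoherentUnits.logDeriv_unitAct`).

Everything is proved (0 sorry).

## References

* E. de Shalit, *Iwasawa theory of elliptic curves with complex multiplication* (1987), Ch. I §3.13–3.14. [deShalit1987]
-/

noncomputable section

open scoped PowerSeries.WithPiTopology

namespace Literature.NumberTheory.GaloisRepresentations

section LocalFieldTZI

open GaloisRepresentations.IsNonarchimedeanLocalField LubinTate ValuativeRel

variable (F : Type*) [Field F] [ValuativeRel F] [TopologicalSpace F] [IsNonarchimedeanLocalField F]

attribute [local instance] ltNormUniformSpace ltNormIsUniformAddGroup rk1 nF nE fintypeResidueField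

variable {F}
variable {π : 𝒪[F]} (hπ : (valuation F).IsUniformizer (π : F)) (n : ℕ)

/-- `f` is substitutable (`f(0) = 0`). [folklore] -/
private theorem hasSubst_ltSer' : PowerSeries.HasSubst (ltSer F π) :=
  PowerSeries.HasSubst.of_constantCoeff_zero' (isLTSeries_ltSer π).constantCoeff_eq_zero

/-- `[v]_f` is substitutable (`[v](0) = 0`). [folklore] -/
private theorem hasSubst_hom' (v : LTCoeff F) :
    PowerSeries.HasSubst (hom (isLTRing_LTCoeff hπ) (isLTSeries_LTCoeff π) (isLTSeries_LTCoeff π) v) :=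
  PowerSeries.HasSubst.of_constantCoeff_zero' (constantCoeff_hom _ _ _ v)

/-! ### Traces of constants -/

/-- **`𝒮 1 = q`.** [cite: deShalit1987, Ch. I §3.12 (23)] -/
theorem colemanTrace_one : colemanTrace hπ n 1 = PowerSeries.C (residueFieldCard F : LTCoeff F) := by
  have h := colemanTrace_subst_ltSer hπ n 1
  rwa [← PowerSeries.coe_substAlgHom hasSubst_ltSer', map_one, mul_one] at h

/-- **`𝒮(a) = q · a`** for a constant `a`. [cite: deShalit1987, Ch. I §3.12 (23)] -/
theorem colemanTrace_C (a : LTCoeff F) :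
    colemanTrace hπ n (PowerSeries.C a) = PowerSeries.C (residueFieldCard F * a) := by
  rw [← mul_one (PowerSeries.C a), colemanTrace_C_mul, colemanTrace_one, ← map_mul, mul_comm]

/-- `ã = (1 − u) a` for a constant `a`. [cite: deShalit1987, Ch. I §3.3 (7')] -/
theorem tildeSer_C (u a : LTCoeff F) : tildeSer π u (PowerSeries.C a) = PowerSeries.C ((1 - u) * a) := by
  rw [tildeSer_def, PowerSeries.subst_C]
  change PowerSeries.C a - PowerSeries.C u * PowerSeries.C a = _
  rw [← map_mul, ← map_sub]; ring_nf

/-- `h ↦ h̃` is compatible with subtraction. [cite: deShalit1987, Ch. I §3.3] -/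
theorem tildeSer_sub (u : LTCoeff F) (h h' : PowerSeries (LTCoeff F)) :
    tildeSer π u (h - h') = tildeSer π u h - tildeSer π u h' := by
  rw [tildeSer_def, tildeSer_def, tildeSer_def, ← PowerSeries.coe_substAlgHom hasSubst_ltSer', map_sub]; ring

/-! ### The image of `𝓔_π` -/

include hπ in
/-- ★★★ **The image of `h ↦ h̃` on `𝓔_π` (`π = q u`)**: every `g` with `𝒮g = 0` and `g(0) = (1 − u) c` is `h̃` for
some `h` with `h(0) = c` and `𝒮h = πh` (take `h = h₁ + c`, `h₁` the solution of `h₁ = (g − (1−u)c) + u · (h₁ ∘ f)`).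
Together with `constantCoeff_tildeSer` (`h̃(0) = (1−u)h(0)`): **`(𝓔_π)~ = {g : 𝒮g = 0, g(0) ∈ (1 − u)𝒪[F]}`**.
[cite: deShalit1987, Ch. I §3.13 Lemma] -/
theorem exists_tildeSer_eq {u : LTCoeff F} (hu : LTCoeff.of F π = residueFieldCard F * u)
    {g : PowerSeries (LTCoeff F)} (hg : colemanTrace hπ n g = 0) {c : LTCoeff F}
    (hgc : PowerSeries.constantCoeff g = (1 - u) * c) :
    ∃ h : PowerSeries (LTCoeff F), PowerSeries.constantCoeff h = c ∧ tildeSer π u h = g ∧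
      colemanTrace hπ n h = PowerSeries.C (LTCoeff.of F π) * h := by
  set g₀ := g - PowerSeries.C ((1 - u) * c) with hg₀
  have hg₀0 : PowerSeries.constantCoeff g₀ = 0 := by
    rw [hg₀, map_sub, PowerSeries.constantCoeff_C, hgc, sub_self]
  obtain ⟨h₁, hh₁0, hh₁⟩ := exists_eq_add_C_mul_subst hπ u hg₀0
  refine ⟨h₁ + PowerSeries.C c, by rw [map_add, hh₁0, PowerSeries.constantCoeff_C, zero_add], ?_, ?_⟩
  · have h1 : tildeSer π u h₁ = g₀ := by
      rw [tildeSer_def]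
      nth_rewrite 1 [hh₁]
      ring
    rw [tildeSer_add, h1, tildeSer_C, hg₀, sub_add_cancel]
  · rw [colemanTrace_add, colemanTrace_eq_of_eq_add_C_mul_subst hπ n u hh₁, hg₀, colemanTrace_sub, hg,
      colemanTrace_C, colemanTrace_C, hu]
    simp only [map_mul, map_sub, map_one]
    ring

include hπ in
/-- ★★ For `π = q u`: `g` with `𝒮g = 0` is in the image of `𝓔_π` under `h ↦ h̃` **iff** `g(0) ∈ (1 − u)`.
[cite: deShalit1987, Ch. I §3.13 Lemma] -/
theorem exists_tildeSer_eq_iff {u : LTCoeff F} (hu : LTCoeff.of F π = residueFieldCard F * u)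
    {g : PowerSeries (LTCoeff F)} (hg : colemanTrace hπ n g = 0) :
    (∃ h : PowerSeries (LTCoeff F), tildeSer π u h = g ∧ colemanTrace hπ n h = PowerSeries.C (LTCoeff.of F π) * h) ↔
      PowerSeries.constantCoeff g ∈ Ideal.span {1 - u} := by
  constructor
  · rintro ⟨h, rfl, -⟩
    rw [constantCoeff_tildeSer]
    exact Ideal.mem_span_singleton.mpr (dvd_mul_right _ _)
  · intro hmem
    obtain ⟨c, hc⟩ := Ideal.mem_span_singleton.mp hmem
    obtain ⟨h, -, h1, h2⟩ := exists_tildeSer_eq hπ n hu hg hc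
    exact ⟨h, h1, h2⟩

/-! ### The kernel -/

include hπ in
/-- ★★ **The kernel of `h ↦ h̃`**: `h̃ = 0` iff `h` is the constant `h(0)` and `(1 − u) h(0) = 0`.
[cite: deShalit1987, Ch. I §3.14] -/
theorem tildeSer_eq_zero_iff (u : LTCoeff F) (h : PowerSeries (LTCoeff F)) :
    tildeSer π u h = 0 ↔ h = PowerSeries.C (PowerSeries.constantCoeff h) ∧ (1 - u) * PowerSeries.constantCoeff h = 0 := by
  constructor
  · intro h0
    have hc : (1 - u) * PowerSeries.constantCoeff h = 0 := by
      rw [← constantCoeff_tildeSer, h0, map_zero]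
    refine ⟨tildeSer_injective_of_constantCoeff_eq hπ u ?_ (by rw [PowerSeries.constantCoeff_C]), hc⟩
    rw [h0, tildeSer_C, hc, map_zero]
  · rintro ⟨hC, hc⟩
    rw [hC, tildeSer_C, hc, map_zero]

include hπ in
/-- ★ For `u ≠ 1` (`π ≠ q`), `h ↦ h̃` is injective on all of `𝒪[F]⟦X⟧`. [cite: deShalit1987, Ch. I §3.14] -/
theorem tildeSer_injective {u : LTCoeff F} (hu1 : u ≠ 1) : Function.Injective (tildeSer π u) := by
  haveI : IsDomain (LTCoeff F) := inferInstanceAs (IsDomain 𝒪[F])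
  intro h h' he
  have h0 : tildeSer π u (h - h') = 0 := by rw [tildeSer_sub, he, sub_self]
  obtain ⟨hC, hc⟩ := (tildeSer_eq_zero_iff hπ u (h - h')).mp h0
  rcases mul_eq_zero.mp hc with h1 | h1
  · exact absurd (sub_eq_zero.mp h1).symm hu1
  · rw [← sub_eq_zero, hC, h1, map_zero]

include hπ in
/-- ★ For `u = 1` (`π = q`, e.g. the tower `ℚ_p(ζ_{p^∞})` of `pX + X^p`): **`h̃ = 0 ⟺ h` is a constant** — the kernel
of `𝓔 → {𝒮 = 0}` is `𝒪[F]`. [cite: deShalit1987, Ch. I §3.14] -/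
theorem tildeSer_one_eq_zero_iff (h : PowerSeries (LTCoeff F)) :
    tildeSer π 1 h = 0 ↔ h = PowerSeries.C (PowerSeries.constantCoeff h) := by
  rw [tildeSer_eq_zero_iff hπ, sub_self, zero_mul]
  exact ⟨fun h1 => h1.1, fun h1 => ⟨h1, rfl⟩⟩

/-! ### Equivariance -/

/-- `(h ∘ f) ∘ [v] = (h ∘ [v]) ∘ f` (`f ∘ [v] = [v] ∘ f`). [cite: deShalit1987, Ch. I §3.4] -/
theorem subst_hom_subst_ltSer (v : LTCoeff F) (h : PowerSeries (LTCoeff F)) :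
    PowerSeries.subst (hom (isLTRing_LTCoeff hπ) (isLTSeries_LTCoeff π) (isLTSeries_LTCoeff π) v)
        (PowerSeries.subst (ltSer F π) h) =
      PowerSeries.subst (ltSer F π)
        (PowerSeries.subst (hom (isLTRing_LTCoeff hπ) (isLTSeries_LTCoeff π) (isLTSeries_LTCoeff π) v) h) := by
  rw [PowerSeries.subst_comp_subst_apply hasSubst_ltSer' (hasSubst_hom' hπ v),
    PowerSeries.subst_comp_subst_apply (hasSubst_hom' hπ v) hasSubst_ltSer']
  congr 1
  exact subst_hom (isLTRing_LTCoeff hπ) (isLTSeries_LTCoeff π) (isLTSeries_LTCoeff π) v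

/-- ★★ **`h ↦ h̃` commutes with `h ↦ h ∘ [v]_f`** (`v ∈ 𝒪[F]`). [cite: deShalit1987, Ch. I §3.4] -/
theorem tildeSer_subst_hom (u v : LTCoeff F) (h : PowerSeries (LTCoeff F)) :
    tildeSer π u (PowerSeries.subst (hom (isLTRing_LTCoeff hπ) (isLTSeries_LTCoeff π) (isLTSeries_LTCoeff π) v) h) =
      PowerSeries.subst (hom (isLTRing_LTCoeff hπ) (isLTSeries_LTCoeff π) (isLTSeries_LTCoeff π) v)
        (tildeSer π u h) := by
  rw [tildeSer_def, tildeSer_def, ← subst_hom_subst_ltSer hπ, ← PowerSeries.coe_substAlgHom (hasSubst_hom' hπ v),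
    map_sub, map_mul, PowerSeries.coe_substAlgHom, PowerSeries.subst_C]
  rfl

/-- ★ **`{g : 𝒮g = 0}` is stable under `g ↦ g ∘ [v]_f`** for `v ∈ 𝒪[F]ˣ` (`𝒮(g ∘ [v]) = (𝒮g) ∘ [v]`).
[cite: deShalit1987, Ch. I §3.4] -/
theorem colemanTrace_subst_hom_eq_zero (v : 𝒪[F]ˣ) {g : PowerSeries (LTCoeff F)} (hg : colemanTrace hπ n g = 0) :
    colemanTrace hπ n (PowerSeries.subst
      (hom (isLTRing_LTCoeff hπ) (isLTSeries_LTCoeff π) (isLTSeries_LTCoeff π) (LTCoeff.of F (v : 𝒪[F]))) g) = 0 := by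
  rw [colemanTrace_subst_hom, hg, ← PowerSeries.coe_substAlgHom (hasSubst_hom' hπ _), map_zero]

/-- ★ **`𝓔_π` is stable under `h ↦ v · (h ∘ [v]_f)`** (`v ∈ 𝒪[F]ˣ`; this is `δ(σ_v β)` for `h = δβ`,
`NormCoherentUnits.logDeriv_unitAct`). [cite: deShalit1987, Ch. I §3.4 Lemma (ii)] -/
theorem colemanTrace_C_mul_subst_hom_eq (v : 𝒪[F]ˣ) {h : PowerSeries (LTCoeff F)}
    (hh : colemanTrace hπ n h = PowerSeries.C (LTCoeff.of F π) * h) :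
    colemanTrace hπ n (PowerSeries.C (LTCoeff.of F (v : 𝒪[F])) * PowerSeries.subst
      (hom (isLTRing_LTCoeff hπ) (isLTSeries_LTCoeff π) (isLTSeries_LTCoeff π) (LTCoeff.of F (v : 𝒪[F]))) h) =
      PowerSeries.C (LTCoeff.of F π) * (PowerSeries.C (LTCoeff.of F (v : 𝒪[F])) * PowerSeries.subst
        (hom (isLTRing_LTCoeff hπ) (isLTSeries_LTCoeff π) (isLTSeries_LTCoeff π) (LTCoeff.of F (v : 𝒪[F]))) h) := by
  rw [colemanTrace_C_mul, colemanTrace_subst_hom, hh, ← PowerSeries.coe_substAlgHom (hasSubst_hom' hπ _),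
    map_mul, PowerSeries.coe_substAlgHom, PowerSeries.subst_C]
  change _ * (PowerSeries.C _ * _) = _
  ring

/-! ### `π = q · u`: uniformizers differ by units; `ℚ_p` -/

include hπ in
/-- Two uniformizers of `F` are associated — Mathlib's `Valuation.associated_of_isUniformizer`, restated with units
of `𝒪[F]` (`π = π' · w`). [cite: SerreLocalFields1979, Ch. I §1 Prop. 2] -/
theorem exists_eq_mul_unit_of_isUniformizer {π' : 𝒪[F]} (hπ' : (valuation F).IsUniformizer (π' : F)) :
    ∃ w : (𝒪[F])ˣ, π = π' * w :=
  let ⟨w, hw⟩ := Valuation.associated_of_isUniformizer hπ' hπ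
  ⟨w, hw.symm⟩

end LocalFieldTZI

section PadicTZ

open GaloisRepresentations.IsNonarchimedeanLocalField LubinTate ValuativeRel

attribute [local instance] ltNormUniformSpace ltNormIsUniformAddGroup rk1 nF nE fintypeResidueField

/-- **Every uniformizer `π` of `ℚ_p` is `p · u` with `u ∈ ℤ_pˣ`**, in the coefficient ring `LTCoeff ℚ_[p]`:
`π = q · u` with `q = |𝔽_p| = p` — the hypothesis of the `h ↦ h̃` theorems holds for `ℚ_p` and any `π`
(two uniformizers are associated: Mathlib `Valuation.associated_of_isUniformizer`).
[cite: SerreLocalFields1979, Ch. I §1 Prop. 2] -/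
theorem Padic.exists_of_eq_residueFieldCard_mul (p : ℕ) [Fact p.Prime] :
    haveI := Padic.isNonarchimedeanLocalField_holds p
    ∀ {π : 𝒪[ℚ_[p]]}, (valuation ℚ_[p]).IsUniformizer (π : ℚ_[p]) →
      ∃ u : (LTCoeff ℚ_[p])ˣ, LTCoeff.of ℚ_[p] π = residueFieldCard ℚ_[p] * u := by
  haveI := Padic.isNonarchimedeanLocalField_holds p
  intro π hπ
  obtain ⟨w, hw⟩ := exists_eq_mul_unit_of_isUniformizer hπ (Padic.isUniformizer_natCast p)
  refine ⟨Units.map (LTCoeff.of ℚ_[p] : 𝒪[ℚ_[p]] →* LTCoeff ℚ_[p]) w, ?_⟩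
  rw [hw, map_mul, map_natCast, Padic.residueFieldCard_eq p]
  rfl

/-- ★★★ **Over `ℚ₂`, for every uniformizer `π = 2u`: every `g ∈ ℤ₂⟦X⟧` with `𝒮g = 0` and `g(0) ∈ (1 − u)` is
`(δβ)~` for a norm-coherent unit sequence `β` of the tower of `f = πX + X²`** (`δ : 𝒰 ≅ 𝓔_π`, then
`exists_tildeSer_eq`). [cite: deShalit1987, Ch. I §3.14] -/
theorem PadicTwo.exists_normCoherentUnits_tildeSer_logDeriv_eq :
    haveI := Padic.isNonarchimedeanLocalField_holds 2
    ∀ {π : 𝒪[ℚ_[2]]} (hπ : (valuation ℚ_[2]).IsUniformizer (π : ℚ_[2])) {u : LTCoeff ℚ_[2]}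
      (_hu : LTCoeff.of ℚ_[2] π = residueFieldCard ℚ_[2] * u) (n : ℕ) {g : PowerSeries (LTCoeff ℚ_[2])},
      colemanTrace hπ n g = 0 → PowerSeries.constantCoeff g ∈ Ideal.span {1 - u} →
        ∃ β : NormCoherentUnits hπ, tildeSer π u β.logDeriv = g := by
  haveI := Padic.isNonarchimedeanLocalField_holds 2
  intro π hπ u hu n g hg hg0
  obtain ⟨h, hh, hhE⟩ := (exists_tildeSer_eq_iff hπ n hu hg).mpr hg0
  obtain ⟨β, hβ⟩ := NormCoherentUnits.exists_logDeriv_eq hπ n (Padic.residueFieldCard_eq 2)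
    (PadicTwo.exists_sq_dvd_sub_of_isUniformizer hπ) h hhE
  exact ⟨β, by rw [hβ, hh]⟩

/-- ★★ **… and for `π ≠ 2` (`u ≠ 1`) that `β` is unique**: `β ↦ (δβ)~` is injective on `𝒰`.
[cite: deShalit1987, Ch. I §3.14] -/
theorem PadicTwo.normCoherentUnits_tildeSer_logDeriv_injective :
    haveI := Padic.isNonarchimedeanLocalField_holds 2
    ∀ {π : 𝒪[ℚ_[2]]} (hπ : (valuation ℚ_[2]).IsUniformizer (π : ℚ_[2])) {u : LTCoeff ℚ_[2]}, u ≠ 1 →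
      Function.Injective fun β : NormCoherentUnits hπ => tildeSer π u β.logDeriv := by
  haveI := Padic.isNonarchimedeanLocalField_holds 2
  intro π hπ u hu1 β β' he
  exact NormCoherentUnits.logDeriv_injective hπ (Padic.residueFieldCard_eq 2) (tildeSer_injective hπ hu1 he)

end PadicTZ

end Literature.NumberTheory.GaloisRepresentations
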